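import Summits.CriticalPhenomena.PercolationContinuityZ3.Theorems.PercNearOneGluingNoHeavyLowerTailSahiLatinMoves4

/-!
# `NoHeavyLowerTail` (crux stmt-CriticalPhenomena-4575), Sahi programme (prim-master-conj gen 42): the ORDER-4 DESCENT THEOREM in EVERY
# dimension — given FBP(3,d), `K₄ ≥ 0` on all up-set 4-tuples of `[4]^d` iff on the TERMINAL ones (the `n = 4` rung of the ladder)

Support file (`--supports stmt-CriticalPhenomena-4575`; companion of `…SahiLatinKernel4/Moves4`, order-4 analogue of `…SahiLatinDescent`).
Memo `run/shared/lean/prim/prim-l12/FROM-prim-master-conj-g41-DESCENT.md` §10 (ORDER-4 DESCENT THEOREM), §10c (LADDER THEOREM, rung `n = 4`).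

A 4-tuple `(a,b,c,d)` of subsets of `[4]^ι` is TERMINAL (`Terminal4`) if for each slot `s` with the other three `t,u,v`: (C1) no minimal
element of `s` lies in `t ∩ u ∩ v` and (C2) every maximal non-element of `s` lies in `t ∩ u ∩ v`.  R-moves (Lemma R₄, unconditional)
then A-moves (Lemma A₄, which needs FBP(3,|ι|) = `LatinPos ι` for the order-3 kernel of the link) give:
* `exists_terminal4_le` — given `LatinPos ι`, every up-set 4-tuple descends to a terminal up-set 4-tuple with no larger `K₄`;
* **`latinPos4_iff_terminalPos4`** — given `LatinPos ι`: `LatinPos4 ι` (FBP(4,|ι|)) ⟺ `TerminalPos4 ι`.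
With `LatinPos (Fin 3)` a tree theorem (`…SahiLatinThree`), FBP(4,3) — Sahi's `E₄ ≥ 0` on every product of THREE finite chains, beyond
[LiebSahi2022, Thm 3.7] (two chains) — is thereby reduced in the kernel to the finite statement `TerminalPos4 (Fin 3)` (enumerated
outside Lean: 761 288 011 terminal 4-tuples of `[4]³`, `0` negative, memo §10d; the `E₄` bridge is `…SahiLatinBridge4`).
Everything here is proved; axioms standard.
-/

namespace Summit.CriticalPhenomena.PercolationContinuityZ3.Theorems.SahiLatin

open Finset

variable {ι : Type*} [Fintype ι] [DecidableEq ι]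

/-! ## Terminal 4-tuples -/

/-- `m` is a minimal element of `s ⊆ [4]^ι`. [this work] -/
def IsMinOf₄ (s : Finset (Pt4 ι)) (m : Pt4 ι) : Prop := m ∈ s ∧ ∀ y ∈ s, y ≤ m → y = m

/-- `m` is a maximal element of the complement of `s ⊆ [4]^ι`. [this work] -/
def IsMaxOut₄ (s : Finset (Pt4 ι)) (m : Pt4 ι) : Prop := m ∉ s ∧ ∀ y, m ≤ y → y ≠ m → y ∈ s

/-- (C1) for slot `s` against `t, u, v`: no minimal element of `s` lies in `t ∩ u ∩ v`. [this work] -/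
def C1₄ (s t u v : Finset (Pt4 ι)) : Prop := ∀ m, IsMinOf₄ s m → ¬ (m ∈ t ∧ m ∈ u ∧ m ∈ v)

/-- (C2) for slot `s` against `t, u, v`: every maximal non-element of `s` lies in `t ∩ u ∩ v`. [this work] -/
def C2₄ (s t u v : Finset (Pt4 ι)) : Prop := ∀ m, IsMaxOut₄ s m → m ∈ t ∧ m ∈ u ∧ m ∈ v

/-- A TERMINAL 4-tuple: (C1) and (C2) in each of the four slots. [this work] -/
structure Terminal4 (a b c d : Finset (Pt4 ι)) : Prop where
  /-- (C1) for `a`. -/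
  c1a : C1₄ a b c d
  /-- (C1) for `b`. -/
  c1b : C1₄ b a c d
  /-- (C1) for `c`. -/
  c1c : C1₄ c a b d
  /-- (C1) for `d`. -/
  c1d : C1₄ d a b c
  /-- (C2) for `a`. -/
  c2a : C2₄ a b c d
  /-- (C2) for `b`. -/
  c2b : C2₄ b a c d
  /-- (C2) for `c`. -/
  c2c : C2₄ c a b d
  /-- (C2) for `d`. -/
  c2d : C2₄ d a b c

/-- A 4-tuple of up-sets of `[4]^ι`. [this work] -/
def UpQuad (a b c d : Finset (Pt4 ι)) : Prop :=
  IsUpperSet (a : Set (Pt4 ι)) ∧ IsUpperSet (b : Set (Pt4 ι)) ∧ IsUpperSet (c : Set (Pt4 ι)) ∧ IsUpperSet (d : Set (Pt4 ι))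

/-- **FBP(4,d)**: the order-4 Latin kernel is nonnegative on every 4-tuple of up-sets of `[4]^ι`. [this work] -/
def LatinPos4 (ι : Type*) [Fintype ι] [DecidableEq ι] : Prop :=
  ∀ a b c d : Finset (Pt4 ι), UpQuad a b c d → 0 ≤ kappa4 a b c d

/-- TERMINAL POSITIVITY of order 4: `K₄ ≥ 0` on every terminal 4-tuple of up-sets of `[4]^ι`. [this work] -/
def TerminalPos4 (ι : Type*) [Fintype ι] [DecidableEq ι] : Prop :=
  ∀ a b c d : Finset (Pt4 ι), UpQuad a b c d → Terminal4 a b c d → 0 ≤ kappa4 a b c d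

/-! ## (C1) is stable under A-moves -/

omit [DecidableEq ι] in
/-- A minimal element of `insert m s` is `m` or a minimal element of `s`. [this work] -/
theorem isMinOf₄_insert {s : Finset (Pt4 ι)} {m x : Pt4 ι} (hx : IsMinOf₄ (insert m s) x) : x = m ∨ IsMinOf₄ s x := by
  rcases mem_insert.1 hx.1 with h | h
  · exact Or.inl h
  · exact Or.inr ⟨h, fun y hy hyx => hx.2 y (mem_insert_of_mem hy) hyx⟩

omit [DecidableEq ι] in
/-- Insertion into the slot itself preserves (C1) if the new point is outside the other three. [this work] -/
theorem C1₄_insert₁ {s t u v : Finset (Pt4 ι)} (h : C1₄ s t u v) {m : Pt4 ι} (hm : ¬ (m ∈ t ∧ m ∈ u ∧ m ∈ v)) :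
    C1₄ (insert m s) t u v := by
  intro x hx
  rcases isMinOf₄_insert hx with rfl | hx'
  · exact hm
  · exact h x hx'

omit [DecidableEq ι] in
/-- Insertion into the first reference set preserves (C1). [this work] -/
theorem C1₄_insert₂ {s t u v : Finset (Pt4 ι)} (h : C1₄ s t u v) {m : Pt4 ι} (hm : ¬ (m ∈ s ∧ m ∈ u ∧ m ∈ v)) :
    C1₄ s (insert m t) u v := by
  intro x hx hmem
  rcases mem_insert.1 hmem.1 with rfl | hxt
  · exact hm ⟨hx.1, hmem.2.1, hmem.2.2⟩
  · exact h x hx ⟨hxt, hmem.2⟩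

omit [DecidableEq ι] in
/-- Insertion into the second reference set preserves (C1). [this work] -/
theorem C1₄_insert₃ {s t u v : Finset (Pt4 ι)} (h : C1₄ s t u v) {m : Pt4 ι} (hm : ¬ (m ∈ s ∧ m ∈ t ∧ m ∈ v)) :
    C1₄ s t (insert m u) v := by
  intro x hx hmem
  rcases mem_insert.1 hmem.2.1 with rfl | hxu
  · exact hm ⟨hx.1, hmem.1, hmem.2.2⟩
  · exact h x hx ⟨hmem.1, hxu, hmem.2.2⟩

omit [DecidableEq ι] in
/-- Insertion into the third reference set preserves (C1). [this work] -/
theorem C1₄_insert₄ {s t u v : Finset (Pt4 ι)} (h : C1₄ s t u v) {m : Pt4 ι} (hm : ¬ (m ∈ s ∧ m ∈ t ∧ m ∈ u)) :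
    C1₄ s t u (insert m v) := by
  intro x hx hmem
  rcases mem_insert.1 hmem.2.2 with rfl | hxv
  · exact hm ⟨hx.1, hmem.1, hmem.2.1⟩
  · exact h x hx ⟨hmem.1, hmem.2.1, hxv⟩

/-- Inserting a new point lowers the size of the complement. [this work] -/
theorem card_compl_insert_lt₄ {s : Finset (Pt4 ι)} {m : Pt4 ι} (hm : m ∉ s) : (insert m s)ᶜ.card < sᶜ.card := by
  rw [compl_insert]
  exact card_erase_lt_of_mem (mem_compl.2 hm)

/-! ## Phase A -/

/-- Phase A of the order-4 descent (given FBP(3,d)): from an up-set 4-tuple satisfying (C1) in every slot, A-moves reach a terminal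
up-set 4-tuple with no larger `K₄` (strong induction on `Σ |sᶜ|`). [this work] -/
theorem exists_terminal4_le_of_C1 (hpos : LatinPos ι) : ∀ (n : ℕ) (a b c d : Finset (Pt4 ι)),
    aᶜ.card + bᶜ.card + cᶜ.card + dᶜ.card = n → UpQuad a b c d → C1₄ a b c d → C1₄ b a c d → C1₄ c a b d → C1₄ d a b c →
    ∃ a' b' c' d' : Finset (Pt4 ι), UpQuad a' b' c' d' ∧ Terminal4 a' b' c' d' ∧ kappa4 a' b' c' d' ≤ kappa4 a b c d := by
  intro n
  induction n using Nat.strong_induction_on with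
  | _ n ih =>
    intro a b c d hn hup h1a h1b h1c h1d
    obtain ⟨ha, hb, hc, hd⟩ := hup
    by_cases hA : ∃ m, IsMaxOut₄ a m ∧ ¬ (m ∈ b ∧ m ∈ c ∧ m ∈ d)
    · obtain ⟨m, hm, hmo⟩ := hA
      have hlt : (insert m a)ᶜ.card + bᶜ.card + cᶜ.card + dᶜ.card < n := by
        have := card_compl_insert_lt₄ hm.1; omega
      obtain ⟨a', b', c', d', hup', hT, hle⟩ := ih _ hlt (insert m a) b c d rfl
        ⟨isUpperSet_insert_of_maximal₄ ha hm.2, hb, hc, hd⟩ (C1₄_insert₁ h1a hmo) (C1₄_insert₂ h1b hmo)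
        (C1₄_insert₂ h1c fun h => hmo ⟨h.2.1, h.1, h.2.2⟩) (C1₄_insert₂ h1d fun h => hmo ⟨h.2.1, h.2.2, h.1⟩)
      exact ⟨a', b', c', d', hup', hT, hle.trans (kappa4_insert_le hpos hb hc hd hm.1 hmo)⟩
    by_cases hB : ∃ m, IsMaxOut₄ b m ∧ ¬ (m ∈ a ∧ m ∈ c ∧ m ∈ d)
    · obtain ⟨m, hm, hmo⟩ := hB
      have hlt : aᶜ.card + (insert m b)ᶜ.card + cᶜ.card + dᶜ.card < n := by
        have := card_compl_insert_lt₄ hm.1; omega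
      obtain ⟨a', b', c', d', hup', hT, hle⟩ := ih _ hlt a (insert m b) c d rfl
        ⟨ha, isUpperSet_insert_of_maximal₄ hb hm.2, hc, hd⟩ (C1₄_insert₂ h1a hmo) (C1₄_insert₁ h1b hmo)
        (C1₄_insert₃ h1c fun h => hmo ⟨h.2.1, h.1, h.2.2⟩) (C1₄_insert₃ h1d fun h => hmo ⟨h.2.1, h.2.2, h.1⟩)
      exact ⟨a', b', c', d', hup', hT, hle.trans (kappa4_insert_le₂ hpos ha hc hd hm.1 hmo)⟩
    by_cases hC : ∃ m, IsMaxOut₄ c m ∧ ¬ (m ∈ a ∧ m ∈ b ∧ m ∈ d)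
    · obtain ⟨m, hm, hmo⟩ := hC
      have hlt : aᶜ.card + bᶜ.card + (insert m c)ᶜ.card + dᶜ.card < n := by
        have := card_compl_insert_lt₄ hm.1; omega
      obtain ⟨a', b', c', d', hup', hT, hle⟩ := ih _ hlt a b (insert m c) d rfl
        ⟨ha, hb, isUpperSet_insert_of_maximal₄ hc hm.2, hd⟩ (C1₄_insert₃ h1a hmo) (C1₄_insert₃ h1b fun h => hmo ⟨h.2.1, h.1, h.2.2⟩)
        (C1₄_insert₁ h1c hmo) (C1₄_insert₄ h1d fun h => hmo ⟨h.2.1, h.2.2, h.1⟩)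
      exact ⟨a', b', c', d', hup', hT, hle.trans (kappa4_insert_le₃ hpos ha hb hd hm.1 hmo)⟩
    by_cases hD : ∃ m, IsMaxOut₄ d m ∧ ¬ (m ∈ a ∧ m ∈ b ∧ m ∈ c)
    · obtain ⟨m, hm, hmo⟩ := hD
      have hlt : aᶜ.card + bᶜ.card + cᶜ.card + (insert m d)ᶜ.card < n := by
        have := card_compl_insert_lt₄ hm.1; omega
      obtain ⟨a', b', c', d', hup', hT, hle⟩ := ih _ hlt a b c (insert m d) rfl
        ⟨ha, hb, hc, isUpperSet_insert_of_maximal₄ hd hm.2⟩ (C1₄_insert₄ h1a hmo) (C1₄_insert₄ h1b fun h => hmo ⟨h.2.1, h.1, h.2.2⟩)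
        (C1₄_insert₄ h1c fun h => hmo ⟨h.2.1, h.2.2, h.1⟩) (C1₄_insert₁ h1d hmo)
      exact ⟨a', b', c', d', hup', hT, hle.trans (kappa4_insert_le₄ hpos ha hb hc hm.1 hmo)⟩
    push Not at hA hB hC hD
    exact ⟨a, b, c, d, ⟨ha, hb, hc, hd⟩, ⟨h1a, h1b, h1c, h1d, hA, hB, hC, hD⟩, le_rfl⟩

/-! ## Phase R, then phase A -/

/-- The full order-4 descent (strong induction on `|a|+|b|+|c|+|d|` for phase R, then `exists_terminal4_le_of_C1`). [this work] -/
theorem exists_terminal4_le_aux (hpos : LatinPos ι) : ∀ (n : ℕ) (a b c d : Finset (Pt4 ι)),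
    a.card + b.card + c.card + d.card = n → UpQuad a b c d →
    ∃ a' b' c' d' : Finset (Pt4 ι), UpQuad a' b' c' d' ∧ Terminal4 a' b' c' d' ∧ kappa4 a' b' c' d' ≤ kappa4 a b c d := by
  intro n
  induction n using Nat.strong_induction_on with
  | _ n ih =>
    intro a b c d hn hup
    obtain ⟨ha, hb, hc, hd⟩ := hup
    by_cases hA : ∃ m, IsMinOf₄ a m ∧ (m ∈ b ∧ m ∈ c ∧ m ∈ d)
    · obtain ⟨m, hm, hmb, hmc, hmd⟩ := hA
      have hlt : (a.erase m).card + b.card + c.card + d.card < n := by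
        have := card_erase_lt_of_mem hm.1; omega
      obtain ⟨a', b', c', d', hup', hT, hle⟩ :=
        ih _ hlt (a.erase m) b c d rfl ⟨isUpperSet_erase_of_minimal₄ ha hm.2, hb, hc, hd⟩
      exact ⟨a', b', c', d', hup', hT, hle.trans (kappa4_erase_le hm.1 hmb hmc hmd)⟩
    by_cases hB : ∃ m, IsMinOf₄ b m ∧ (m ∈ a ∧ m ∈ c ∧ m ∈ d)
    · obtain ⟨m, hm, hma, hmc, hmd⟩ := hB
      have hlt : a.card + (b.erase m).card + c.card + d.card < n := by
        have := card_erase_lt_of_mem hm.1; omega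
      obtain ⟨a', b', c', d', hup', hT, hle⟩ :=
        ih _ hlt a (b.erase m) c d rfl ⟨ha, isUpperSet_erase_of_minimal₄ hb hm.2, hc, hd⟩
      exact ⟨a', b', c', d', hup', hT, hle.trans (kappa4_erase_le₂ hm.1 hma hmc hmd)⟩
    by_cases hC : ∃ m, IsMinOf₄ c m ∧ (m ∈ a ∧ m ∈ b ∧ m ∈ d)
    · obtain ⟨m, hm, hma, hmb, hmd⟩ := hC
      have hlt : a.card + b.card + (c.erase m).card + d.card < n := by
        have := card_erase_lt_of_mem hm.1; omega
      obtain ⟨a', b', c', d', hup', hT, hle⟩ :=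
        ih _ hlt a b (c.erase m) d rfl ⟨ha, hb, isUpperSet_erase_of_minimal₄ hc hm.2, hd⟩
      exact ⟨a', b', c', d', hup', hT, hle.trans (kappa4_erase_le₃ hm.1 hma hmb hmd)⟩
    by_cases hD : ∃ m, IsMinOf₄ d m ∧ (m ∈ a ∧ m ∈ b ∧ m ∈ c)
    · obtain ⟨m, hm, hma, hmb, hmc⟩ := hD
      have hlt : a.card + b.card + c.card + (d.erase m).card < n := by
        have := card_erase_lt_of_mem hm.1; omega
      obtain ⟨a', b', c', d', hup', hT, hle⟩ :=
        ih _ hlt a b c (d.erase m) rfl ⟨ha, hb, hc, isUpperSet_erase_of_minimal₄ hd hm.2⟩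
      exact ⟨a', b', c', d', hup', hT, hle.trans (kappa4_erase_le₄ hm.1 hma hmb hmc)⟩
    push Not at hA hB hC hD
    exact exists_terminal4_le_of_C1 hpos _ a b c d rfl ⟨ha, hb, hc, hd⟩ (fun m hm h => hA m hm h.1 h.2.1 h.2.2)
      (fun m hm h => hB m hm h.1 h.2.1 h.2.2) (fun m hm h => hC m hm h.1 h.2.1 h.2.2) (fun m hm h => hD m hm h.1 h.2.1 h.2.2)

/-- **ORDER-4 DESCENT THEOREM** (all `d`, given FBP(3,d)).  Every 4-tuple of up-sets of `[4]^ι` descends to a TERMINAL 4-tuple of up-sets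
with no larger order-4 Latin kernel. [this work] -/
theorem exists_terminal4_le (hpos : LatinPos ι) {a b c d : Finset (Pt4 ι)} (hup : UpQuad a b c d) :
    ∃ a' b' c' d' : Finset (Pt4 ι), UpQuad a' b' c' d' ∧ Terminal4 a' b' c' d' ∧ kappa4 a' b' c' d' ≤ kappa4 a b c d :=
  exists_terminal4_le_aux hpos _ a b c d rfl hup

/-- **The `n = 4` rung of the ladder** (all `d`): given FBP(3,d), FBP(4,d) ⟺ terminal positivity of order 4. [this work] -/
theorem latinPos4_iff_terminalPos4 (hpos : LatinPos ι) : LatinPos4 ι ↔ TerminalPos4 ι := by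
  constructor
  · exact fun h a b c d hup _ => h a b c d hup
  · intro h a b c d hup
    obtain ⟨a', b', c', d', hup', hT, hle⟩ := exists_terminal4_le hpos hup
    exact (h a' b' c' d' hup' hT).trans hle

end Summit.CriticalPhenomena.PercolationContinuityZ3.Theorems.SahiLatin
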